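import Mathlib.Analysis.Calculus.FDeriv.Symmetric
import Mathlib.Analysis.Calculus.Deriv.Mul
import Summits.AtomisticToContinuum.FouriersLaw.Theorems.LocalOhmBVNoLocalIntegralsSites

/-!
# `NoLocalIntegrals` helper B: calculus of the coordinate partial derivatives

Helper file of the support item `NoLocalIntegrals` (stmt-AtomisticToContinuum-12074) of route `LocalOhmBV`
(sub-problem `FouriersLaw`): the rules of the coordinate partial derivatives `partialQZ x`, `partialPZ x`
(`InfiniteChainInvariantStates`) on smooth local observables — linearity, Leibniz and chain rules,
derivatives of the coordinates, covariance under `shiftPow` / `reflectZ` / freezing a site, SCHWARZ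
(mixed partials commute), and the converse of locality: an observable whose two partial derivatives at
a site vanish identically does not depend on that site.
-/

noncomputable section

open scoped ContDiff
open Set Function Literature.MathematicalPhysics.KineticTheory.HeatConduction

namespace Summit.AtomisticToContinuum.FouriersLaw.Theorems.LocalOhmBV

variable {f g : ChainConfig → ℝ}

/-! ### The partial derivatives as derivatives along coordinate lines -/

/-- `∂_{q_x} f` at a configuration updated at `x` is the derivative of the position line through it. -/
theorem partialQZ_update_eq_deriv (f : ChainConfig → ℝ) (σ : ChainConfig) (x : ℤ) (t c : ℝ) :
    partialQZ x f (Function.update σ x (t, c)) = deriv (fun s => f (Function.update σ x (s, c))) t := by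
  simp only [partialQZ, Function.update_self, Function.update_idem]

/-- `∂_{p_x} f` at a configuration updated at `x` is the derivative of the momentum line through it. -/
theorem partialPZ_update_eq_deriv (f : ChainConfig → ℝ) (σ : ChainConfig) (x : ℤ) (c t : ℝ) :
    partialPZ x f (Function.update σ x (c, t)) = deriv (fun s => f (Function.update σ x (c, s))) t := by
  simp only [partialPZ, Function.update_self, Function.update_idem]

/-- The position line of a smooth local observable has derivative `∂_{q_x} f`. -/
theorem hasDerivAt_lineQ (hf : IsSmoothLocal f) (σ : ChainConfig) (x : ℤ) (c t : ℝ) :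
    HasDerivAt (fun s => f (Function.update σ x (s, c))) (partialQZ x f (Function.update σ x (t, c))) t := by
  rw [partialQZ_update_eq_deriv]
  exact (((contDiff_lineQ hf σ x c).differentiable (by simp)) t).hasDerivAt

/-- The momentum line of a smooth local observable has derivative `∂_{p_x} f`. -/
theorem hasDerivAt_lineP (hf : IsSmoothLocal f) (σ : ChainConfig) (x : ℤ) (c t : ℝ) :
    HasDerivAt (fun s => f (Function.update σ x (c, s))) (partialPZ x f (Function.update σ x (c, t))) t := by
  rw [partialPZ_update_eq_deriv]
  exact (((contDiff_lineP hf σ x c).differentiable (by simp)) t).hasDerivAt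

/-- The position line through `σ` itself has derivative `∂_{q_x} f (σ)` at `q_x`. -/
theorem hasDerivAt_lineQ_self (hf : IsSmoothLocal f) (σ : ChainConfig) (x : ℤ) :
    HasDerivAt (fun s => f (Function.update σ x (s, (σ x).2))) (partialQZ x f σ) (σ x).1 := by
  have h := hasDerivAt_lineQ hf σ x (σ x).2 (σ x).1
  rwa [Prod.mk.eta, Function.update_eq_self] at h

/-- The momentum line through `σ` itself has derivative `∂_{p_x} f (σ)` at `p_x`. -/
theorem hasDerivAt_lineP_self (hf : IsSmoothLocal f) (σ : ChainConfig) (x : ℤ) :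
    HasDerivAt (fun s => f (Function.update σ x ((σ x).1, s))) (partialPZ x f σ) (σ x).2 := by
  have h := hasDerivAt_lineP hf σ x (σ x).1 (σ x).2
  rwa [Prod.mk.eta, Function.update_eq_self] at h

/-! ### Linearity, Leibniz rule, chain rule -/

/-- `∂_{q_x}` is additive on smooth local observables. -/
theorem partialQZ_add (x : ℤ) (hf : IsSmoothLocal f) (hg : IsSmoothLocal g) :
    partialQZ x (fun σ => f σ + g σ) = fun σ => partialQZ x f σ + partialQZ x g σ := by
  funext σ
  exact ((hasDerivAt_lineQ_self hf σ x).add (hasDerivAt_lineQ_self hg σ x)).deriv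

/-- `∂_{p_x}` is additive on smooth local observables. -/
theorem partialPZ_add (x : ℤ) (hf : IsSmoothLocal f) (hg : IsSmoothLocal g) :
    partialPZ x (fun σ => f σ + g σ) = fun σ => partialPZ x f σ + partialPZ x g σ := by
  funext σ
  exact ((hasDerivAt_lineP_self hf σ x).add (hasDerivAt_lineP_self hg σ x)).deriv

/-- `∂_{q_x}` of a difference. -/
theorem partialQZ_sub (x : ℤ) (hf : IsSmoothLocal f) (hg : IsSmoothLocal g) :
    partialQZ x (fun σ => f σ - g σ) = fun σ => partialQZ x f σ - partialQZ x g σ := by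
  funext σ
  exact ((hasDerivAt_lineQ_self hf σ x).sub (hasDerivAt_lineQ_self hg σ x)).deriv

/-- `∂_{p_x}` of a difference. -/
theorem partialPZ_sub (x : ℤ) (hf : IsSmoothLocal f) (hg : IsSmoothLocal g) :
    partialPZ x (fun σ => f σ - g σ) = fun σ => partialPZ x f σ - partialPZ x g σ := by
  funext σ
  exact ((hasDerivAt_lineP_self hf σ x).sub (hasDerivAt_lineP_self hg σ x)).deriv

/-- Leibniz rule for `∂_{q_x}`. -/
theorem partialQZ_mul (x : ℤ) (hf : IsSmoothLocal f) (hg : IsSmoothLocal g) :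
    partialQZ x (fun σ => f σ * g σ) = fun σ => partialQZ x f σ * g σ + f σ * partialQZ x g σ := by
  funext σ
  have h := ((hasDerivAt_lineQ_self hf σ x).mul (hasDerivAt_lineQ_self hg σ x)).deriv
  simp only [Prod.mk.eta, Function.update_eq_self] at h
  exact h

/-- Leibniz rule for `∂_{p_x}`. -/
theorem partialPZ_mul (x : ℤ) (hf : IsSmoothLocal f) (hg : IsSmoothLocal g) :
    partialPZ x (fun σ => f σ * g σ) = fun σ => partialPZ x f σ * g σ + f σ * partialPZ x g σ := by
  funext σ
  have h := ((hasDerivAt_lineP_self hf σ x).mul (hasDerivAt_lineP_self hg σ x)).deriv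
  simp only [Prod.mk.eta, Function.update_eq_self] at h
  exact h

/-- `∂_{q_x}` of a constant vanishes (no hypothesis). -/
@[simp] theorem partialQZ_const (x : ℤ) (c : ℝ) : partialQZ x (fun _ : ChainConfig => c) = 0 := by
  funext σ; simp [partialQZ]

/-- `∂_{p_x}` of a constant vanishes (no hypothesis). -/
@[simp] theorem partialPZ_const (x : ℤ) (c : ℝ) : partialPZ x (fun _ : ChainConfig => c) = 0 := by
  funext σ; simp [partialPZ]

/-- `∂_{q_x} 0 = 0`. -/
@[simp] theorem partialQZ_zero (x : ℤ) : partialQZ x (0 : ChainConfig → ℝ) = 0 :=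
  partialQZ_const x 0

/-- `∂_{p_x} 0 = 0`. -/
@[simp] theorem partialPZ_zero (x : ℤ) : partialPZ x (0 : ChainConfig → ℝ) = 0 :=
  partialPZ_const x 0

/-- `∂_{q_x}` commutes with constant factors (no hypothesis). -/
theorem partialQZ_const_mul (x : ℤ) (c : ℝ) (f : ChainConfig → ℝ) :
    partialQZ x (fun σ => c * f σ) = fun σ => c * partialQZ x f σ := by
  funext σ; simp only [partialQZ, deriv_const_mul_field']

/-- `∂_{p_x}` commutes with constant factors (no hypothesis). -/
theorem partialPZ_const_mul (x : ℤ) (c : ℝ) (f : ChainConfig → ℝ) :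
    partialPZ x (fun σ => c * f σ) = fun σ => c * partialPZ x f σ := by
  funext σ; simp only [partialPZ, deriv_const_mul_field']

/-- `∂_{q_x}` of a negation (no hypothesis). -/
theorem partialQZ_neg (x : ℤ) (f : ChainConfig → ℝ) :
    partialQZ x (fun σ => -f σ) = fun σ => -partialQZ x f σ := by
  funext σ; simp only [partialQZ, deriv.fun_neg']

/-- `∂_{p_x}` of a negation (no hypothesis). -/
theorem partialPZ_neg (x : ℤ) (f : ChainConfig → ℝ) :
    partialPZ x (fun σ => -f σ) = fun σ => -partialPZ x f σ := by
  funext σ; simp only [partialPZ, deriv.fun_neg']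

/-- `∂_{q_x}` of a finite sum of smooth local observables. -/
theorem partialQZ_sum (x : ℤ) {ι : Type*} (s : Finset ι) {F : ι → ChainConfig → ℝ}
    (hF : ∀ i ∈ s, IsSmoothLocal (F i)) :
    partialQZ x (fun σ => ∑ i ∈ s, F i σ) = fun σ => ∑ i ∈ s, partialQZ x (F i) σ := by
  classical
  induction s using Finset.induction_on with
  | empty => funext σ; simp
  | insert a s ha ih =>
    have h1 : IsSmoothLocal (F a) := hF a (Finset.mem_insert_self a s)
    have h2 : ∀ i ∈ s, IsSmoothLocal (F i) := fun i hi => hF i (Finset.mem_insert_of_mem hi)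
    simp only [Finset.sum_insert ha]
    rw [partialQZ_add x h1 (isSmoothLocal_sum s h2), ih h2]

/-- `∂_{p_x}` of a finite sum of smooth local observables. -/
theorem partialPZ_sum (x : ℤ) {ι : Type*} (s : Finset ι) {F : ι → ChainConfig → ℝ}
    (hF : ∀ i ∈ s, IsSmoothLocal (F i)) :
    partialPZ x (fun σ => ∑ i ∈ s, F i σ) = fun σ => ∑ i ∈ s, partialPZ x (F i) σ := by
  classical
  induction s using Finset.induction_on with
  | empty => funext σ; simp
  | insert a s ha ih =>
    have h1 : IsSmoothLocal (F a) := hF a (Finset.mem_insert_self a s)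
    have h2 : ∀ i ∈ s, IsSmoothLocal (F i) := fun i hi => hF i (Finset.mem_insert_of_mem hi)
    simp only [Finset.sum_insert ha]
    rw [partialPZ_add x h1 (isSmoothLocal_sum s h2), ih h2]

/-- Chain rule for `∂_{q_x}` with a differentiable outer function. -/
theorem partialQZ_comp (x : ℤ) {φ : ℝ → ℝ} (hφ : Differentiable ℝ φ) (hf : IsSmoothLocal f) :
    partialQZ x (fun σ => φ (f σ)) = fun σ => deriv φ (f σ) * partialQZ x f σ := by
  funext σ
  have h2 : HasDerivAt φ (deriv φ (f σ)) (f (Function.update σ x ((σ x).1, (σ x).2))) := by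
    rw [Prod.mk.eta, Function.update_eq_self]
    exact (hφ _).hasDerivAt
  exact (h2.comp ((σ x).1) (hasDerivAt_lineQ_self hf σ x)).deriv

/-- Chain rule for `∂_{p_x}` with a differentiable outer function. -/
theorem partialPZ_comp (x : ℤ) {φ : ℝ → ℝ} (hφ : Differentiable ℝ φ) (hf : IsSmoothLocal f) :
    partialPZ x (fun σ => φ (f σ)) = fun σ => deriv φ (f σ) * partialPZ x f σ := by
  funext σ
  have h2 : HasDerivAt φ (deriv φ (f σ)) (f (Function.update σ x ((σ x).1, (σ x).2))) := by
    rw [Prod.mk.eta, Function.update_eq_self]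
    exact (hφ _).hasDerivAt
  exact (h2.comp ((σ x).2) (hasDerivAt_lineP_self hf σ x)).deriv

/-! ### Derivatives of the coordinates -/

/-- `∂_{q_x} q_y = δ_{xy}`. -/
theorem partialQZ_fst (x y : ℤ) :
    partialQZ x (fun σ : ChainConfig => (σ y).1) = fun _ => if y = x then 1 else 0 := by
  funext σ
  unfold partialQZ
  by_cases h : y = x
  · subst h; simp
  · simp [h]

/-- `∂_{q_x} p_y = 0`. -/
theorem partialQZ_snd (x y : ℤ) : partialQZ x (fun σ : ChainConfig => (σ y).2) = fun _ => 0 := by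
  funext σ
  unfold partialQZ
  by_cases h : y = x
  · subst h; simp
  · simp [h]

/-- `∂_{p_x} q_y = 0`. -/
theorem partialPZ_fst (x y : ℤ) : partialPZ x (fun σ : ChainConfig => (σ y).1) = fun _ => 0 := by
  funext σ
  unfold partialPZ
  by_cases h : y = x
  · subst h; simp
  · simp [h]

/-- `∂_{p_x} p_y = δ_{xy}`. -/
theorem partialPZ_snd (x y : ℤ) :
    partialPZ x (fun σ : ChainConfig => (σ y).2) = fun _ => if y = x then 1 else 0 := by
  funext σ
  unfold partialPZ
  by_cases h : y = x
  · subst h; simp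
  · simp [h]

/-! ### Covariance under re-indexing and freezing -/

/-- The iterated shift conjugates site updates. -/
theorem shiftPow_update (k : ℤ) (σ : ChainConfig) (x : ℤ) (v : ℝ × ℝ) :
    shiftPow k (Function.update σ x v) = Function.update (shiftPow k σ) (x - k) v := by
  funext y
  by_cases hy : y = x - k
  · subst hy; simp
  · have : y + k ≠ x := fun h => hy (by omega)
    simp [Function.update_of_ne this, Function.update_of_ne hy]

/-- The reflection conjugates site updates. -/
theorem reflectZ_update (σ : ChainConfig) (x : ℤ) (v : ℝ × ℝ) :
    reflectZ (Function.update σ x v) = Function.update (reflectZ σ) (-x) v := by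
  funext y
  by_cases hy : y = -x
  · subst hy; simp
  · have : -y ≠ x := fun h => hy (by omega)
    simp [Function.update_of_ne this, Function.update_of_ne hy]

/-- `∂_{q_x}(f ∘ τᵏ) = (∂_{q_{x-k}} f) ∘ τᵏ` (no hypothesis). -/
theorem partialQZ_comp_shiftPow (k x : ℤ) (f : ChainConfig → ℝ) (σ : ChainConfig) :
    partialQZ x (f ∘ shiftPow k) σ = partialQZ (x - k) f (shiftPow k σ) := by
  simp only [partialQZ, Function.comp_apply, shiftPow_update, shiftPow_apply, sub_add_cancel]

/-- `∂_{p_x}(f ∘ τᵏ) = (∂_{p_{x-k}} f) ∘ τᵏ` (no hypothesis). -/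
theorem partialPZ_comp_shiftPow (k x : ℤ) (f : ChainConfig → ℝ) (σ : ChainConfig) :
    partialPZ x (f ∘ shiftPow k) σ = partialPZ (x - k) f (shiftPow k σ) := by
  simp only [partialPZ, Function.comp_apply, shiftPow_update, shiftPow_apply, sub_add_cancel]

/-- `∂_{q_x}(f ∘ ρ) = (∂_{q_{-x}} f) ∘ ρ` (no hypothesis). -/
theorem partialQZ_comp_reflectZ (x : ℤ) (f : ChainConfig → ℝ) (σ : ChainConfig) :
    partialQZ x (f ∘ reflectZ) σ = partialQZ (-x) f (reflectZ σ) := by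
  simp only [partialQZ, Function.comp_apply, reflectZ_update, reflectZ_apply, neg_neg]

/-- `∂_{p_x}(f ∘ ρ) = (∂_{p_{-x}} f) ∘ ρ` (no hypothesis). -/
theorem partialPZ_comp_reflectZ (x : ℤ) (f : ChainConfig → ℝ) (σ : ChainConfig) :
    partialPZ x (f ∘ reflectZ) σ = partialPZ (-x) f (reflectZ σ) := by
  simp only [partialPZ, Function.comp_apply, reflectZ_update, reflectZ_apply, neg_neg]

/-- `∂_{q_x}` commutes with freezing another site (no hypothesis). -/
theorem partialQZ_comp_update_of_ne {x y : ℤ} (hxy : x ≠ y) (f : ChainConfig → ℝ) (v : ℝ × ℝ)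
    (σ : ChainConfig) :
    partialQZ x (fun σ => f (Function.update σ y v)) σ = partialQZ x f (Function.update σ y v) := by
  simp only [partialQZ, Function.update_of_ne hxy, Function.update_comm hxy]

/-- `∂_{p_x}` commutes with freezing another site (no hypothesis). -/
theorem partialPZ_comp_update_of_ne {x y : ℤ} (hxy : x ≠ y) (f : ChainConfig → ℝ) (v : ℝ × ℝ)
    (σ : ChainConfig) :
    partialPZ x (fun σ => f (Function.update σ y v)) σ = partialPZ x f (Function.update σ y v) := by
  simp only [partialPZ, Function.update_of_ne hxy, Function.update_comm hxy]

/-- An observable frozen at `x` has `∂_{q_x} = 0` (no hypothesis). -/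
theorem partialQZ_comp_update_self (x : ℤ) (f : ChainConfig → ℝ) (v : ℝ × ℝ) :
    partialQZ x (fun σ => f (Function.update σ x v)) = 0 := by
  funext σ; simp [partialQZ]

/-- An observable frozen at `x` has `∂_{p_x} = 0` (no hypothesis). -/
theorem partialPZ_comp_update_self (x : ℤ) (f : ChainConfig → ℝ) (v : ℝ × ℝ) :
    partialPZ x (fun σ => f (Function.update σ x v)) = 0 := by
  funext σ; simp [partialPZ]

/-! ### Schwarz: mixed partial derivatives of a smooth local observable commute -/

/-- A smooth local observable is represented on a centred box containing two prescribed sites, both as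
explicit box indices. -/
theorem isSmoothLocal_exists_rep_site₂ (hf : IsSmoothLocal f) (x y : ℤ) :
    ∃ (R : ℕ) (g : (Fin (2 * R + 1) → ℝ × ℝ) → ℝ) (i j : Fin (2 * R + 1)),
      ContDiff ℝ ∞ g ∧ f = g ∘ boxRestrict R ∧ ((i : ℤ) - R = x) ∧ ((j : ℤ) - R = y) := by
  obtain ⟨R₀, h⟩ := isSmoothLocal_exists_rep hf
  set R := max R₀ (max x.natAbs y.natAbs) with hR
  obtain ⟨g, hg, rfl⟩ := h R (le_max_left _ _)
  have hx : x.natAbs ≤ R := (le_max_left _ _).trans (le_max_right _ _)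
  have hy : y.natAbs ≤ R := (le_max_right _ _).trans (le_max_right _ _)
  exact ⟨R, g, ⟨(x + R).toNat, by omega⟩, ⟨(y + R).toNat, by omega⟩, hg, rfl,
    by simp only; omega, by simp only; omega⟩

/-- The derivative of `z ↦ Dg(z)·w` is `v ↦ D²g(z)(v, w)` (any smooth profile on a normed space). -/
theorem hasFDerivAt_fderiv_apply_const {E : Type*} [NormedAddCommGroup E] [NormedSpace ℝ E]
    {g : E → ℝ} (hg : ContDiff ℝ ∞ g) (z w : E) :
    HasFDerivAt (fun y => fderiv ℝ g y w) ((fderiv ℝ (fderiv ℝ g) z).flip w) z := by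
  have hd : DifferentiableAt ℝ (fderiv ℝ g) z :=
    ((hg.fderiv_right (m := ∞) (by simp)).differentiable (by simp)) z
  have := hd.hasFDerivAt.clm_apply (hasFDerivAt_const w z)
  simpa using this

/-- Second coordinate partials of `g ∘ box_R` through second derivatives of the profile: position after
any first partial `z ↦ Dg(z)·w`. -/
theorem partialQZ_fderiv_comp_boxRestrict {R : ℕ} {g : (Fin (2 * R + 1) → ℝ × ℝ) → ℝ}
    (hg : ContDiff ℝ ∞ g) (i : Fin (2 * R + 1)) (w : Fin (2 * R + 1) → ℝ × ℝ) :
    partialQZ ((i : ℤ) - R) ((fun y => fderiv ℝ g y w) ∘ boxRestrict R) =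
      (fun y => fderiv ℝ (fderiv ℝ g) y (Pi.single i (1, 0)) w) ∘ boxRestrict R := by
  rw [partialQZ_comp_boxRestrict (contDiff_fderiv_apply_const hg w) i]
  funext σ
  simp only [Function.comp_apply, (hasFDerivAt_fderiv_apply_const hg _ w).fderiv,
    ContinuousLinearMap.flip_apply]

/-- Second coordinate partials of `g ∘ box_R` through second derivatives of the profile: momentum after
any first partial `z ↦ Dg(z)·w`. -/
theorem partialPZ_fderiv_comp_boxRestrict {R : ℕ} {g : (Fin (2 * R + 1) → ℝ × ℝ) → ℝ}
    (hg : ContDiff ℝ ∞ g) (i : Fin (2 * R + 1)) (w : Fin (2 * R + 1) → ℝ × ℝ) :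
    partialPZ ((i : ℤ) - R) ((fun y => fderiv ℝ g y w) ∘ boxRestrict R) =
      (fun y => fderiv ℝ (fderiv ℝ g) y (Pi.single i (0, 1)) w) ∘ boxRestrict R := by
  rw [partialPZ_comp_boxRestrict (contDiff_fderiv_apply_const hg w) i]
  funext σ
  simp only [Function.comp_apply, (hasFDerivAt_fderiv_apply_const hg _ w).fderiv,
    ContinuousLinearMap.flip_apply]

/-- Second derivatives of a smooth profile are symmetric. -/
theorem fderiv_fderiv_symm' {E : Type*} [NormedAddCommGroup E] [NormedSpace ℝ E] {g : E → ℝ}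
    (hg : ContDiff ℝ ∞ g) (z v w : E) :
    fderiv ℝ (fderiv ℝ g) z v w = fderiv ℝ (fderiv ℝ g) z w v :=
  (hg.contDiffAt.isSymmSndFDerivAt (by simp only [minSmoothness_of_isRCLikeNormedField]; exact WithTop.coe_le_coe.2 le_top)) v w

/-- **Schwarz**: `∂_{q_x} ∂_{p_y} f = ∂_{p_y} ∂_{q_x} f` for a smooth local observable. -/
theorem partialQZ_partialPZ_comm (hf : IsSmoothLocal f) (x y : ℤ) :
    partialQZ x (partialPZ y f) = partialPZ y (partialQZ x f) := by
  obtain ⟨R, g, i, j, hg, rfl, rfl, rfl⟩ := isSmoothLocal_exists_rep_site₂ hf x y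
  rw [partialPZ_comp_boxRestrict hg j, partialQZ_comp_boxRestrict hg i,
    partialQZ_fderiv_comp_boxRestrict hg, partialPZ_fderiv_comp_boxRestrict hg]
  funext σ
  exact fderiv_fderiv_symm' hg _ _ _

/-- **Schwarz**: `∂_{q_x} ∂_{q_y} f = ∂_{q_y} ∂_{q_x} f` for a smooth local observable. -/
theorem partialQZ_partialQZ_comm (hf : IsSmoothLocal f) (x y : ℤ) :
    partialQZ x (partialQZ y f) = partialQZ y (partialQZ x f) := by
  obtain ⟨R, g, i, j, hg, rfl, rfl, rfl⟩ := isSmoothLocal_exists_rep_site₂ hf x y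
  rw [partialQZ_comp_boxRestrict hg j, partialQZ_comp_boxRestrict hg i,
    partialQZ_fderiv_comp_boxRestrict hg, partialQZ_fderiv_comp_boxRestrict hg]
  funext σ
  exact fderiv_fderiv_symm' hg _ _ _

/-- **Schwarz**: `∂_{p_x} ∂_{p_y} f = ∂_{p_y} ∂_{p_x} f` for a smooth local observable. -/
theorem partialPZ_partialPZ_comm (hf : IsSmoothLocal f) (x y : ℤ) :
    partialPZ x (partialPZ y f) = partialPZ y (partialPZ x f) := by
  obtain ⟨R, g, i, j, hg, rfl, rfl, rfl⟩ := isSmoothLocal_exists_rep_site₂ hf x y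
  rw [partialPZ_comp_boxRestrict hg j, partialPZ_comp_boxRestrict hg i,
    partialPZ_fderiv_comp_boxRestrict hg, partialPZ_fderiv_comp_boxRestrict hg]
  funext σ
  exact fderiv_fderiv_symm' hg _ _ _

end Summit.AtomisticToContinuum.FouriersLaw.Theorems.LocalOhmBV
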